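import Summits.ValiantsHypothesis.ValiantsHypothesis.Theorems.SymPencilPerFourPeeledFlatRankLemmas

/-!
# Route `SymPencil` — inner rank of the `2 | 2` row split of `per_4`, PEELED case: the
# flattening-rank lemma F5 (`--supports` stmt-ValiantsHypothesis-5674 `SdcSuperquadratic`; (8,8)
# column, memo `NOTE-p6g16-5674-R2-peeled-ten.md` §3)

Pure linear algebra (no project imports).  With `E[(b,k),(a,l)] = [a,b,k,l pairwise distinct]`
(the flattening of `per_4` against the split `(b,y₂) | (a,y₃)`), the `16 × 16` matrix
`E − X ⊗ Y`, `(X ⊗ Y)[(b,k),(a,l)] = X_{ak} Y_{bl}`, has rank at least `5` for ALL `4 × 4` matrices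
`X, Y`: it does NOT factor through `K⁴`.  This is what contradicts the rank-four factorisation of
`…PeeledFactor.factor_of_peeled_ten` (memo §2 (★)).

Proof (memo §3, streamlined).  Rows `ρ_{bk}` (indexed by `(a,l)`, read as `4 × 4` matrices):
`ρ_{bk} = ε_{bk} − x_k ⊗ y_b` with `ε_{bk} = E_{pq} + E_{qp}` (`{p,q} = {b,k}ᶜ`, `b ≠ k`), `ε_{bb} = 0`.
If all rows lie in a space `U` of dimension `≤ 4`, put `β(M) := X M Y`, `D := im β`,
`SZD :=` symmetric zero-diagonal matrices (dim `6`), `DA :=` matrices with antisymmetric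
off-diagonal part.  Then `SZD ≤ U + D`, `β(DA) ≤ U ∩ D`, whence `dim β(DA) + 2 ≤ dim (SZD ∩ D)`.
If `X, Y` are invertible the left side is `≥ 7 > 6`; otherwise a kernel vector of `Y` (or of `Xᵀ`)
is killed by every `T ∈ SZD ∩ D`, forcing `dim (SZD ∩ D) ≤ 3`, so `dim β(DA) ≤ 1`; but a non-zero
`T = XMY ∈ SZD` makes `X` have two independent columns and `Y ≠ 0`, which gives two independent
elements of `β(DA)`.  Honest framing: helper lemma; no cell closes here; `27 ≤ sdc(per_4) ≤ 29`,
the crux and `VP ≠ VNP` untouched.  No definitions, no named facts. [folklore]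
-/

noncomputable section

-- single-conjunct layout: Sub = Summit, duplicated namespace component intended
set_option linter.dupNamespace false

namespace Summit.ValiantsHypothesis.ValiantsHypothesis.Theorems.SymPencilPerFourPeeledFlatRank

open Matrix Finset Module
open Summit.ValiantsHypothesis.ValiantsHypothesis.Theorems.SymPencilPerFourPeeledFlatRankLemmas

variable {K : Type*} [Field K]

/-- The endgame of F5: no pair `(P, Q)` with `P ≤ ` symmetric zero-diagonal matrices of the form
`X M Y`, `Q ∋ x_b ⊗ y_b, x_b ⊗ y_k − x_k ⊗ y_b` (`x` = columns of `X`, `y` = rows of `Y`),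
`dim Q + 2 ≤ dim P ≤ 6`, and `dim Q ≥ 10` when `M ↦ X M Y` is injective. [folklore] -/
theorem endgame [CharZero K] (X Y : Matrix (Fin 4) (Fin 4) K)
    (P Q : Submodule K (Matrix (Fin 4) (Fin 4) K))
    (hP : ∀ T ∈ P, Tᵀ = T ∧ (∀ i, T i i = 0) ∧ ∃ M : Matrix (Fin 4) (Fin 4) K, X * M * Y = T)
    (hQ1 : ∀ b, vecMulVec (fun a => X a b) (fun l => Y b l) ∈ Q)
    (hQ2 : ∀ b k, b ≠ k →
      vecMulVec (fun a => X a b) (fun l => Y k l) - vecMulVec (fun a => X a k) (fun l => Y b l) ∈ Q)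
    (hQ10 : (∀ M : Matrix (Fin 4) (Fin 4) K, X * M * Y = 0 → M = 0) → 10 ≤ finrank K Q)
    (hineq : finrank K Q + 2 ≤ finrank K P) (hP6 : finrank K P ≤ 6) : False := by
  classical
  set xc : Fin 4 → Fin 4 → K := fun i a => X a i with hxc
  set yr : Fin 4 → Fin 4 → K := fun j l => Y j l with hyr
  -- a pair of independent elements of `Q` forces `finrank Q ≥ 2`
  have two_le : ∀ m₁ m₂ : Matrix (Fin 4) (Fin 4) K, m₁ ∈ Q → m₂ ∈ Q →
      (∀ s t : K, s • m₁ + t • m₂ = 0 → s = 0 ∧ t = 0) → 2 ≤ finrank K Q := by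
    intro m₁ m₂ h₁ h₂ hind
    let fam : Fin 2 → Q := ![⟨m₁, h₁⟩, ⟨m₂, h₂⟩]
    have hli : LinearIndependent K fam := by
      apply LinearIndependent.of_comp Q.subtype
      have : (⇑Q.subtype ∘ fam) = ![m₁, m₂] := by
        funext i; fin_cases i <;> rfl
      rw [this, LinearIndependent.pair_iff]
      exact hind
    simpa using hli.fintype_card_le_finrank
  -- CASE 1: `M ↦ X M Y` injective
  by_cases hinj : ∀ M : Matrix (Fin 4) (Fin 4) K, X * M * Y = 0 → M = 0
  · have := hQ10 hinj; omega
  -- CASE 2: a non-zero `M₀` with `X M₀ Y = 0` ⇒ `X` or `Y` singular ⇒ common kernel vector of `P`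
  push Not at hinj
  obtain ⟨M₀, hXMY, hM₀⟩ := hinj
  have hsing : X.det = 0 ∨ Y.det = 0 := by
    by_contra hc
    push Not at hc
    have hX : IsUnit X.det := isUnit_iff_ne_zero.2 hc.1
    have hY : IsUnit Y.det := isUnit_iff_ne_zero.2 hc.2
    apply hM₀
    calc M₀ = X⁻¹ * (X * M₀ * Y) * Y⁻¹ := by
          rw [← Matrix.mul_assoc, ← Matrix.mul_assoc, Matrix.nonsing_inv_mul X hX, Matrix.one_mul,
            Matrix.mul_assoc, Matrix.mul_nonsing_inv Y hY, Matrix.mul_one]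
      _ = 0 := by rw [hXMY, Matrix.mul_zero, Matrix.zero_mul]
  have hv : ∃ v : Fin 4 → K, v ≠ 0 ∧ ∀ T ∈ P, T *ᵥ v = 0 := by
    rcases hsing with hX | hY
    · obtain ⟨u, hu, huX⟩ := Matrix.exists_vecMul_eq_zero_iff.2 hX
      refine ⟨u, hu, fun T hT => ?_⟩
      obtain ⟨hs, -, ⟨M', hM'⟩⟩ := hP T hT
      rw [← hs, mulVec_transpose, ← hM', ← vecMul_vecMul, ← vecMul_vecMul, huX, zero_vecMul,
        zero_vecMul]
    · obtain ⟨v, hv, hYv⟩ := Matrix.exists_mulVec_eq_zero_iff.2 hY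
      refine ⟨v, hv, fun T hT => ?_⟩
      obtain ⟨-, -, ⟨M', hM'⟩⟩ := hP T hT
      rw [← hM', ← mulVec_mulVec, ← mulVec_mulVec, hYv, mulVec_zero, mulVec_zero]
  obtain ⟨v, hv0, hv⟩ := hv
  have hs3 : finrank K P ≤ 3 :=
    finrank_le_three_of_mulVec_eq_zero v hv0 P fun T hT => ⟨(hP T hT).1, (hP T hT).2.1, hv T hT⟩
  -- a non-zero `T ∈ P`
  have hne : P ≠ ⊥ := by
    intro hbot; rw [hbot, finrank_bot] at hineq; omega
  obtain ⟨T, hT, hT0⟩ := Submodule.exists_mem_ne_zero_of_ne_bot hne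
  obtain ⟨hTs, hTd, ⟨M₁, hM₁⟩⟩ := hP T hT
  have sy : ∀ i j, T j i = T i j := fun i j => by
    have := congrFun (congrFun hTs i) j; simpa only [transpose_apply] using this
  obtain ⟨p, q, hpq⟩ : ∃ p q, T p q ≠ 0 := by
    by_contra hc; push Not at hc
    exact hT0 (Matrix.ext fun i j => hc i j)
  -- the columns `p, q` of `T` are independent and lie in the column space of `X`
  have hcol : ∀ l, (fun a => T a l) = X *ᵥ fun a => (M₁ * Y) a l := by
    intro l; funext a
    rw [← hM₁, Matrix.mul_assoc]
    simp only [Matrix.mul_apply, mulVec, dotProduct]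
  have hind : LinearIndependent K ![X *ᵥ fun a => (M₁ * Y) a p, X *ᵥ fun a => (M₁ * Y) a q] := by
    rw [← hcol p, ← hcol q, LinearIndependent.pair_iff]
    intro s t hst
    have ep := congrFun hst p
    have eq' := congrFun hst q
    simp only [Pi.add_apply, Pi.smul_apply, smul_eq_mul, Pi.zero_apply, hTd, mul_zero,
      zero_add, add_zero] at ep eq'
    rw [sy] at eq'
    exact ⟨(mul_eq_zero.1 eq').resolve_right hpq, (mul_eq_zero.1 ep).resolve_right hpq⟩
  obtain ⟨b, k, hbk⟩ := exists_indep_cols X _ _ hind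
  have hbk' : b ≠ k := by
    intro h; subst h
    rw [LinearIndependent.pair_iff] at hbk
    have := hbk 1 (-1) (by simp)
    exact one_ne_zero this.1
  have hkb : LinearIndependent K ![xc k, xc b] := by
    rw [LinearIndependent.pair_iff] at hbk ⊢
    intro s t hst
    have := hbk t s (by rw [add_comm]; exact hst)
    exact ⟨this.2, this.1⟩
  -- `Y ≠ 0`
  have hY0 : ∃ j, yr j ≠ 0 := by
    by_contra hc; push Not at hc
    apply hT0
    rw [← hM₁]
    have : Y = 0 := by ext j l; exact congrFun (hc j) l
    rw [this, Matrix.mul_zero]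
  have vz : ∀ x : Fin 4 → K, vecMulVec x (0 : Fin 4 → K) = 0 := fun x => by
    ext a l; simp [vecMulVec_apply]
  -- two independent elements of `Q` in every case
  have he2 : 2 ≤ finrank K Q := by
    by_cases hyb : yr b = 0 <;> by_cases hyk : yr k = 0
    · obtain ⟨j, hj⟩ := hY0
      have hjb : b ≠ j := fun h => hj (h ▸ hyb)
      have hjk : k ≠ j := fun h => hj (h ▸ hyk)
      have m1 := hQ2 b j hjb; have m2 := hQ2 k j hjk
      change vecMulVec (xc b) (yr j) - vecMulVec (xc j) (yr b) ∈ Q at m1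
      change vecMulVec (xc k) (yr j) - vecMulVec (xc j) (yr k) ∈ Q at m2
      rw [hyb, vz, sub_zero] at m1
      rw [hyk, vz, sub_zero] at m2
      exact two_le _ _ m1 m2 (outer_indep (xc b) (xc k) (yr j) (yr j) hbk hj hj)
    · have m1 := hQ1 k; have m2 := hQ2 b k hbk'
      change vecMulVec (xc k) (yr k) ∈ Q at m1
      change vecMulVec (xc b) (yr k) - vecMulVec (xc k) (yr b) ∈ Q at m2
      rw [hyb, vz, sub_zero] at m2
      exact two_le _ _ m1 m2 (outer_indep (xc k) (xc b) (yr k) (yr k) hkb hyk hyk)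
    · have m1 := hQ1 b; have m2 := hQ2 k b hbk'.symm
      change vecMulVec (xc b) (yr b) ∈ Q at m1
      change vecMulVec (xc k) (yr b) - vecMulVec (xc b) (yr k) ∈ Q at m2
      rw [hyk, vz, sub_zero] at m2
      exact two_le _ _ m1 m2 (outer_indep (xc b) (xc k) (yr b) (yr b) hbk hyb hyb)
    · have m1 := hQ1 b; have m2 := hQ1 k
      change vecMulVec (xc b) (yr b) ∈ Q at m1
      change vecMulVec (xc k) (yr k) ∈ Q at m2
      exact two_le _ _ m1 m2 (outer_indep (xc b) (xc k) (yr b) (yr k) hbk hyb hyk)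
  omega

set_option maxHeartbeats 400000 in
/-- **F5 — the flattening `E − X ⊗ Y` never factors through `K⁴`** (memo §3).  With
`E[(b,k),(a,l)] = [a, b, k, l pairwise distinct]`: there are no `X, Y` (`4 × 4`), `G` and
`R₀,…,R₃` with `E[(b,k),(a,l)] − X_{ak} Y_{bl} = Σ_i G(b,k,i) · R_i(a,l)` for all indices.
[folklore] -/
theorem no_rank_four_factor [CharZero K] (X Y : Matrix (Fin 4) (Fin 4) K)
    (R : Fin 4 → Matrix (Fin 4) (Fin 4) K) (G : Fin 4 → Fin 4 → Fin 4 → K)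
    (h : ∀ a b k l : Fin 4,
      (if a ≠ b ∧ a ≠ k ∧ a ≠ l ∧ b ≠ k ∧ b ≠ l ∧ k ≠ l then (1 : K) else 0) - X a k * Y b l =
        ∑ i, G b k i * R i a l) : False := by
  classical
  -- the rows, as `4 × 4` matrices indexed by `(a, l)`
  let ρ : Fin 4 → Fin 4 → Matrix (Fin 4) (Fin 4) K := fun b k => Matrix.of fun a l =>
    (if a ≠ b ∧ a ≠ k ∧ a ≠ l ∧ b ≠ k ∧ b ≠ l ∧ k ≠ l then (1 : K) else 0) - X a k * Y b l
  let U : Submodule K (Matrix (Fin 4) (Fin 4) K) := Submodule.span K (Set.range R)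
  have hρU : ∀ b k, ρ b k ∈ U := by
    intro b k
    have : ρ b k = ∑ i, G b k i • R i := by
      ext a l
      simp only [ρ, Matrix.of_apply, h, Matrix.sum_apply, Matrix.smul_apply, smul_eq_mul]
    rw [this]
    exact Submodule.sum_mem _ fun i _ => Submodule.smul_mem _ _ (Submodule.subset_span ⟨i, rfl⟩)
  have hU4 : finrank K U ≤ 4 := (finrank_range_le_card R).trans (by simp)
  -- β(M) = X M Y and its range D
  let β : Matrix (Fin 4) (Fin 4) K →ₗ[K] Matrix (Fin 4) (Fin 4) K :=
    { toFun := fun M => X * M * Y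
      map_add' := fun M N => by rw [Matrix.mul_add, Matrix.add_mul]
      map_smul' := fun s M => by rw [RingHom.id_apply, Matrix.mul_smul, Matrix.smul_mul] }
  have hβ : ∀ M, β M = X * M * Y := fun M => rfl
  let D : Submodule K (Matrix (Fin 4) (Fin 4) K) := LinearMap.range β
  -- elementary matrices
  let Eₘ : Fin 4 → Fin 4 → Matrix (Fin 4) (Fin 4) K := fun i j =>
    Matrix.of fun a l => if a = i ∧ l = j then (1 : K) else 0
  have hβE : ∀ i j a l, β (Eₘ i j) a l = X a i * Y j l := by
    intro i j a l
    have inner : ∀ m, (X * Eₘ i j) a m = if m = j then X a i else 0 := by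
      intro m
      simp only [Matrix.mul_apply, Eₘ, Matrix.of_apply]
      by_cases hm : m = j
      · simp [hm]
      · simp [hm]
    rw [hβ, Matrix.mul_apply]
    simp only [inner, ite_mul, zero_mul, Finset.sum_ite_eq', Finset.mem_univ, if_true]
  -- symmetric zero-diagonal matrices, and matrices with antisymmetric off-diagonal part
  let SZD : Submodule K (Matrix (Fin 4) (Fin 4) K) :=
    { carrier := {T | Tᵀ = T ∧ ∀ i, T i i = 0}
      add_mem' := fun {T T'} hT hT' => ⟨by rw [transpose_add, hT.1, hT'.1],
        fun i => by rw [Matrix.add_apply, hT.2 i, hT'.2 i, add_zero]⟩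
      zero_mem' := ⟨transpose_zero, fun i => rfl⟩
      smul_mem' := fun s T hT => ⟨by rw [transpose_smul, hT.1],
        fun i => by rw [Matrix.smul_apply, hT.2 i, smul_zero]⟩ }
  have memSZD : ∀ T, T ∈ SZD ↔ Tᵀ = T ∧ ∀ i, T i i = 0 := fun T => Iff.rfl
  let DA : Submodule K (Matrix (Fin 4) (Fin 4) K) :=
    { carrier := {M | ∀ i j, i ≠ j → M i j + M j i = 0}
      add_mem' := fun {M N} hM hN i j hij => by
        simp only [Matrix.add_apply]; linear_combination hM i j hij + hN i j hij
      zero_mem' := fun i j _ => by simp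
      smul_mem' := fun s M hM i j hij => by
        simp only [Matrix.smul_apply, smul_eq_mul]; rw [← mul_add, hM i j hij, mul_zero] }
  have memDA : ∀ M, M ∈ DA ↔ ∀ i j, i ≠ j → M i j + M j i = 0 := fun M => Iff.rfl
  -- ε b k := ρ b k + β(E_kb) is the indicator matrix, symmetric in (b,k), zero for b = k
  let ε : Fin 4 → Fin 4 → Matrix (Fin 4) (Fin 4) K := fun b k => Matrix.of fun a l =>
    if a ≠ b ∧ a ≠ k ∧ a ≠ l ∧ b ≠ k ∧ b ≠ l ∧ k ≠ l then (1 : K) else 0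
  have hε : ∀ b k, ρ b k + β (Eₘ k b) = ε b k := by
    intro b k; ext a l
    simp only [Matrix.add_apply, ρ, ε, Matrix.of_apply, hβE, sub_add_cancel]
  have hεsymm : ∀ b k, ε b k = ε k b := by
    intro b k; ext a l
    simp only [ε, Matrix.of_apply]
    by_cases h1 : a ≠ b ∧ a ≠ k ∧ a ≠ l ∧ b ≠ k ∧ b ≠ l ∧ k ≠ l
    · have h2 : a ≠ k ∧ a ≠ b ∧ a ≠ l ∧ k ≠ b ∧ k ≠ l ∧ b ≠ l :=
        ⟨h1.2.1, h1.1, h1.2.2.1, h1.2.2.2.1.symm, h1.2.2.2.2.2, h1.2.2.2.2.1⟩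
      rw [if_pos h1, if_pos h2]
    · have h2 : ¬(a ≠ k ∧ a ≠ b ∧ a ≠ l ∧ k ≠ b ∧ k ≠ l ∧ b ≠ l) := fun h2 =>
        h1 ⟨h2.2.1, h2.1, h2.2.2.1, h2.2.2.2.1.symm, h2.2.2.2.2.2, h2.2.2.2.2.1⟩
      rw [if_neg h1, if_neg h2]
  have hεdiag : ∀ b, ε b b = 0 := by
    intro b; ext a l
    simp only [ε, Matrix.of_apply, Matrix.zero_apply]
    rw [if_neg]; exact fun h => h.2.2.2.1 rfl
  -- memberships
  have hβEU : ∀ b, β (Eₘ b b) ∈ U := by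
    intro b
    have : β (Eₘ b b) = -ρ b b := by
      have h1 := hε b b; rw [hεdiag] at h1; exact eq_neg_of_add_eq_zero_right h1
    rw [this]; exact U.neg_mem (hρU b b)
  have hβE2U : ∀ b k, β (Eₘ b k) - β (Eₘ k b) ∈ U := by
    intro b k
    have : β (Eₘ b k) - β (Eₘ k b) = ρ b k - ρ k b := by
      have h1 := hε k b; have h2 := hε b k; rw [hεsymm k b] at h1
      rw [eq_sub_of_add_eq' h1, eq_sub_of_add_eq' h2]; abel
    rw [this]; exact U.sub_mem (hρU b k) (hρU k b)
  have hεUD : ∀ b k, ε b k ∈ U ⊔ D := by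
    intro b k; rw [← hε]
    exact Submodule.add_mem_sup (hρU b k) ⟨Eₘ k b, rfl⟩
  -- SZD ≤ U ⊔ D : every symmetric zero-diagonal matrix is a combination of six ε's
  have hSZD_le : SZD ≤ U ⊔ D := by
    intro T hT
    obtain ⟨hs, hd⟩ := hT
    have sy : ∀ i j, T j i = T i j := fun i j => by
      have := congrFun (congrFun hs i) j; simpa only [transpose_apply] using this
    have hdec : T = T 0 1 • ε 2 3 + T 0 2 • ε 1 3 + T 0 3 • ε 1 2 + T 1 2 • ε 0 3 +
        T 1 3 • ε 0 2 + T 2 3 • ε 0 1 := by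
      ext a l
      fin_cases a <;> fin_cases l <;>
        simp [ε, Matrix.add_apply, hd, sy 0 1, sy 0 2, sy 0 3, sy 1 2, sy 1 3, sy 2 3]
    rw [hdec]
    refine Submodule.add_mem _ (Submodule.add_mem _ (Submodule.add_mem _ (Submodule.add_mem _
      (Submodule.add_mem _ (Submodule.smul_mem _ _ (hεUD 2 3)) (Submodule.smul_mem _ _ (hεUD 1 3)))
      (Submodule.smul_mem _ _ (hεUD 1 2))) (Submodule.smul_mem _ _ (hεUD 0 3)))
      (Submodule.smul_mem _ _ (hεUD 0 2))) (Submodule.smul_mem _ _ (hεUD 0 1))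
  -- β(DA) ≤ U ⊓ D (symmetrise the double sum `β M = Σ M i j • β(E i j)`)
  have hMsum : ∀ M : Matrix (Fin 4) (Fin 4) K, M = ∑ i, ∑ j, M i j • Eₘ i j := by
    intro M; ext a l
    simp only [Matrix.sum_apply, Matrix.smul_apply, Eₘ, Matrix.of_apply, smul_eq_mul, mul_ite,
      mul_one, mul_zero]
    have inner : ∀ i, (∑ j, if a = i ∧ l = j then M i j else 0) = if a = i then M i l else 0 := by
      intro i
      by_cases hi : a = i
      · simp [hi]
      · simp [hi]
    simp only [inner, Finset.sum_ite_eq, Finset.mem_univ, if_true]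
  have hβDA : Submodule.map β DA ≤ U ⊓ D := by
    rintro _ ⟨M, hM, rfl⟩
    refine ⟨?_, ⟨M, rfl⟩⟩
    have hM' : ∀ i j, i ≠ j → M j i = -M i j := fun i j hij =>
      eq_neg_of_add_eq_zero_left (hM j i (Ne.symm hij))
    let g : Fin 4 → Fin 4 → Matrix (Fin 4) (Fin 4) K :=
      fun i j => M i j • β (Eₘ i j) + M j i • β (Eₘ j i)
    have hg : ∀ i j, g i j ∈ U := by
      intro i j
      by_cases hij : i = j
      · subst hij
        exact U.add_mem (U.smul_mem _ (hβEU i)) (U.smul_mem _ (hβEU i))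
      · have : g i j = M i j • (β (Eₘ i j) - β (Eₘ j i)) := by
          simp only [g]; rw [hM' i j hij, neg_smul, smul_sub, sub_eq_add_neg]
        rw [this]; exact U.smul_mem _ (hβE2U i j)
    have h2 : (2 : K) • β M = ∑ i, ∑ j, g i j := by
      have e1 : β M = ∑ i, ∑ j, M i j • β (Eₘ i j) := by
        conv_lhs => rw [hMsum M]
        simp only [map_sum, map_smul]
      have e2 : ∑ i, ∑ j, M i j • β (Eₘ i j) = ∑ i, ∑ j, M j i • β (Eₘ j i) :=
        Finset.sum_comm
      rw [two_smul, e1]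
      conv_lhs => rw [e2]
      conv_lhs => arg 1; rw [← e2]
      rw [← Finset.sum_add_distrib]
      refine Finset.sum_congr rfl fun i _ => ?_
      rw [← Finset.sum_add_distrib]
    have hsum : (2 : K) • β M ∈ U := by
      rw [h2]; exact U.sum_mem fun i _ => U.sum_mem fun j _ => hg i j
    have := U.smul_mem (2 : K)⁻¹ hsum
    rwa [smul_smul, inv_mul_cancel₀ (two_ne_zero (α := K)), one_smul] at this
  -- SZD ⊓ DA = ⊥ (characteristic ≠ 2)
  have hdisj : SZD ⊓ DA = ⊥ := by
    rw [Submodule.eq_bot_iff]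
    rintro T ⟨⟨hs, hd⟩, hA⟩
    ext i j
    rw [Matrix.zero_apply]
    by_cases hij : i = j
    · subst hij; exact hd i
    · have h1 := hA i j hij
      have h2 : T j i = T i j := by
        have := congrFun (congrFun hs i) j; simpa only [transpose_apply] using this
      rw [h2, ← two_mul] at h1
      exact (mul_eq_zero.1 h1).resolve_left two_ne_zero
  -- dim SZD ≥ 6 and dim DA ≥ 10
  have hSZD6 : 6 ≤ finrank K SZD := six_le_finrank_szd SZD fun T hs hd => ⟨hs, hd⟩
  have hDA10 : 10 ≤ finrank K DA := ten_le_finrank_da DA fun M hM => hM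
  -- hence dim SZD = 6 and dim DA = 10 (they are complementary in the 16-dimensional space)
  have h16 : finrank K (Matrix (Fin 4) (Fin 4) K) = 16 := by
    rw [Module.finrank_matrix]; simp
  have hSD := Submodule.finrank_sup_add_finrank_inf_eq SZD DA
  rw [hdisj, finrank_bot, add_zero] at hSD
  have hle16 : finrank K ↥(SZD ⊔ DA) ≤ 16 := h16 ▸ Submodule.finrank_le (SZD ⊔ DA)
  have hSZD : finrank K SZD = 6 := by omega
  have hDA : finrank K DA = 10 := by omega
  -- the dimension count (†): finrank (map β DA) + 2 ≤ finrank (SZD ⊓ D)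
  have hsup : SZD ⊔ D ≤ U ⊔ D := sup_le (hSZD_le) le_sup_right
  have h1 := Submodule.finrank_sup_add_finrank_inf_eq SZD D
  have h2 := Submodule.finrank_sup_add_finrank_inf_eq U D
  have h3 := Submodule.finrank_mono hsup
  have h4 := Submodule.finrank_mono hβDA
  have hdag : finrank K ↥(Submodule.map β DA) + 2 ≤ finrank K ↥(SZD ⊓ D) := by omega
  have hs6 : finrank K ↥(SZD ⊓ D) ≤ 6 := hSZD ▸ Submodule.finrank_mono inf_le_left
  -- memberships of the elementary images in `map β DA`
  have memEd : ∀ b, Eₘ b b ∈ DA := by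
    intro b i j hij
    simp only [Eₘ, Matrix.of_apply]
    rw [if_neg, if_neg, add_zero]
    · rintro ⟨rfl, rfl⟩; exact hij rfl
    · rintro ⟨rfl, rfl⟩; exact hij rfl
  have memEa : ∀ b k, b ≠ k → Eₘ b k - Eₘ k b ∈ DA := by
    intro b k _ i j _
    simp only [Eₘ, Matrix.sub_apply, Matrix.of_apply]
    have hA : (if j = k ∧ i = b then (1 : K) else 0) = if i = b ∧ j = k then 1 else 0 := by
      by_cases h' : i = b ∧ j = k
      · rw [if_pos h', if_pos ⟨h'.2, h'.1⟩]
      · rw [if_neg h', if_neg (fun h'' => h' ⟨h''.2, h''.1⟩)]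
    have hB : (if j = b ∧ i = k then (1 : K) else 0) = if i = k ∧ j = b then 1 else 0 := by
      by_cases h' : i = k ∧ j = b
      · rw [if_pos h', if_pos ⟨h'.2, h'.1⟩]
      · rw [if_neg h', if_neg (fun h'' => h' ⟨h''.2, h''.1⟩)]
    rw [hA, hB]; ring
  have hβvec : ∀ i j, β (Eₘ i j) = vecMulVec (fun a => X a i) (fun l => Y j l) := by
    intro i j; ext a l; rw [hβE, vecMulVec_apply]
  refine endgame X Y (SZD ⊓ D) (Submodule.map β DA)
    (fun T hT => ⟨hT.1.1, hT.1.2, ?_⟩) (fun b => ⟨Eₘ b b, memEd b, hβvec b b⟩)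
    (fun b k hbk => ⟨Eₘ b k - Eₘ k b, memEa b k hbk, by rw [map_sub, hβvec, hβvec]⟩)
    (fun hinj => ?_) hdag hs6
  · obtain ⟨M', hM'⟩ := hT.2
    exact ⟨M', hM'⟩
  · have hinj' : Function.Injective β := by
      rw [← LinearMap.ker_eq_bot, LinearMap.ker_eq_bot']
      intro M hM; exact hinj M hM
    rw [← LinearEquiv.finrank_eq (Submodule.equivMapOfInjective β hinj' DA)]
    exact hDA10

end Summit.ValiantsHypothesis.ValiantsHypothesis.Theorems.SymPencilPerFourPeeledFlatRank

end
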